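import Mathlib.LinearAlgebra.TensorProduct.Basis
import Mathlib.LinearAlgebra.Basis.VectorSpace
import Mathlib.LinearAlgebra.Dual.Lemmas
import HarnessLib

/-!
# The commutant of `1 ⊗ S` in `End(V ⊗ W)` when `S ⊆ End(W)` has scalar commutant

Topic `Literature/LinearAlgebra`; namespace `Literature.LinearAlgebra`.  For vector spaces `V`, `W` over a field `k`
and a set `S` of endomorphisms of `W` whose commutant is `k · id` (Schur property, e.g. `S` = the operators of an
irreducible admissible representation on `W`):

* **`exists_tmul_eq_of_commute_lTensor`**: an endomorphism `T` of `V ⊗ W` commuting with `id ⊗ s` for all `s ∈ S`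
  is of the form `v ⊗ w ↦ B v ⊗ w` for a linear `B : V → V` (`T = B ⊗ id`, `eq_rTensor_of_commute_lTensor`), and `B`
  is unique when `W ≠ 0` (`eq_of_tmul_eq_tmul`).

Proof: for a functional `μ ∈ V^*` and `v ∈ V` the map `w ↦ (μ ⊗ id)(T(v ⊗ w))` commutes with `S`, hence is a scalar
`c(μ, v)`; with bases of `V`, `W` the coordinates of `T(v ⊗ w)` are `c(μ_i, v) · w_j`, and `c(μ_i, v) = μ_i(B v)` for
`B v := (id ⊗ λ₀)(T(v ⊗ w₀))`, `λ₀(w₀) = 1`.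

This is the elementary algebra behind the realisation of the metaplectic group of an orthogonal direct sum
`W₁ ⊕ W₂` on `S₁ ⊗ S₂` [MoeglinVignerasWaldspurger1987, Chap. 2 II.1 Rem. (6)]: an operator of `S₁ ⊗ S₂` commuting
with the (irreducible) Heisenberg group of the second summand comes from `S₁` — used for the finite-adelic factor of
`Literature.NumberTheory.Weil1964.AdelicMetaplecticSumStripping`.  Only the linear algebra is here.

## References

* [MoeglinVignerasWaldspurger1987] C. Mœglin, M.-F. Vignéras, J.-L. Waldspurger, *Correspondances de Howe sur un corps
  p-adique*, LNM 1291 (1987), Chap. 2 I.3 (irreducibility, Schur), II.1 Rem. (6) — the application.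
-/

set_option autoImplicit false

namespace Literature.LinearAlgebra

open scoped TensorProduct

variable {k : Type*} [Field k] {V W : Type*} [AddCommGroup V] [Module k V] [AddCommGroup W] [Module k W]

/-- `(μ ⊗ λ)(z)` computed in the two orders: `μ (rid ((id ⊗ λ) z)) = λ (lid ((μ ⊗ id) z))`. [folklore] -/
private theorem dual_rid_lTensor_eq_dual_lid_rTensor (μ : Module.Dual k V) (l : Module.Dual k W) (z : V ⊗[k] W) :
    μ (TensorProduct.rid k V (LinearMap.lTensor V l z)) = l (TensorProduct.lid k W (LinearMap.rTensor W μ z)) := by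
  induction z using TensorProduct.induction_on with
  | zero => simp
  | tmul v w =>
    rw [LinearMap.lTensor_tmul, LinearMap.rTensor_tmul, TensorProduct.rid_tmul, TensorProduct.lid_tmul, map_smul,
      map_smul, smul_eq_mul, smul_eq_mul, mul_comm]
  | add x y hx hy => simp only [map_add, hx, hy]

/-- Coordinates in a tensor basis are read through the first-factor coordinate functionals:
`repr_{b ⊗ c}(z)(i, j) = repr_c(lid((b^*_i ⊗ id) z))(j)`. [folklore] -/
private theorem tensorProduct_repr_eq {ι κ : Type*} (b : Module.Basis ι k V) (c : Module.Basis κ k W)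
    (z : V ⊗[k] W) (i : ι) (j : κ) :
    (b.tensorProduct c).repr z (i, j) = c.repr (TensorProduct.lid k W (LinearMap.rTensor W (b.coord i) z)) j := by
  induction z using TensorProduct.induction_on with
  | zero => simp
  | tmul v w =>
    rw [Module.Basis.tensorProduct_repr_tmul_apply, LinearMap.rTensor_tmul, TensorProduct.lid_tmul, map_smul,
      Finsupp.smul_apply, Module.Basis.coord_apply, smul_eq_mul, smul_eq_mul, mul_comm]
  | add x y hx hy => simp only [map_add, Finsupp.add_apply, hx, hy]

/-- `lid` intertwines `id_k ⊗ s` with `s`. [folklore] -/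
private theorem lid_lTensor (s : W →ₗ[k] W) (z : k ⊗[k] W) :
    TensorProduct.lid k W (LinearMap.lTensor k s z) = s (TensorProduct.lid k W z) := by
  induction z using TensorProduct.induction_on with
  | zero => simp
  | tmul a w => rw [LinearMap.lTensor_tmul, TensorProduct.lid_tmul, TensorProduct.lid_tmul, map_smul]
  | add x y hx hy => simp only [map_add, hx, hy]

/-- The **slice map** of `T` at `(μ, v)`: `w ↦ lid ((μ ⊗ id) (T (v ⊗ w)))`, an endomorphism of `W`. [folklore] -/
private def sliceEnd (T : V ⊗[k] W →ₗ[k] V ⊗[k] W) (μ : Module.Dual k V) (v : V) : W →ₗ[k] W :=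
  (TensorProduct.lid k W).toLinearMap ∘ₗ LinearMap.rTensor W μ ∘ₗ T ∘ₗ TensorProduct.mk k V W v

/-- Unfolding of `sliceEnd`. [folklore] -/
private theorem sliceEnd_apply (T : V ⊗[k] W →ₗ[k] V ⊗[k] W) (μ : Module.Dual k V) (v : V) (w : W) :
    sliceEnd T μ v w = TensorProduct.lid k W (LinearMap.rTensor W μ (T (v ⊗ₜ w))) := rfl

/-- If `T` commutes with `id ⊗ s`, its slice maps commute with `s`. [folklore] -/
private theorem sliceEnd_comm {S : Set (W →ₗ[k] W)} (T : V ⊗[k] W →ₗ[k] V ⊗[k] W)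
    (hT : ∀ s ∈ S, T ∘ₗ LinearMap.lTensor V s = LinearMap.lTensor V s ∘ₗ T) (μ : Module.Dual k V) (v : V) :
    ∀ s ∈ S, sliceEnd T μ v ∘ₗ s = s ∘ₗ sliceEnd T μ v := by
  intro s hs
  apply LinearMap.ext
  intro w
  rw [LinearMap.comp_apply, LinearMap.comp_apply, sliceEnd_apply, sliceEnd_apply, ← LinearMap.lTensor_tmul,
    ← LinearMap.comp_apply (f := T), hT s hs, LinearMap.comp_apply, ← LinearMap.comp_apply (f := LinearMap.rTensor W μ),
    LinearMap.rTensor_comp_lTensor, ← LinearMap.lTensor_comp_rTensor, LinearMap.comp_apply, lid_lTensor]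

/-- **The commutant of `1 ⊗ S` is `End(V) ⊗ 1` when `S` has scalar commutant.**  Let `S ⊆ End_k(W)` be such that
every endomorphism of `W` commuting with all of `S` is a scalar, and let `T ∈ End_k(V ⊗ W)` commute with `id ⊗ s`
for every `s ∈ S`.  Then there is a linear `B : V → V` with `T (v ⊗ w) = B v ⊗ w` for all `v, w`.  (The algebra of
[MoeglinVignerasWaldspurger1987, Chap. 2 II.1 Rem. (6)]: operators of `S₁ ⊗ S₂` commuting with the irreducible second
factor come from the first.) [cite: MoeglinVignerasWaldspurger1987, Chap. 2 II.1 Rem. (6)] -/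
theorem exists_tmul_eq_of_commute_lTensor {S : Set (W →ₗ[k] W)}
    (hS : ∀ f : W →ₗ[k] W, (∀ s ∈ S, f ∘ₗ s = s ∘ₗ f) → ∃ c : k, f = c • LinearMap.id)
    (T : V ⊗[k] W →ₗ[k] V ⊗[k] W) (hT : ∀ s ∈ S, T ∘ₗ LinearMap.lTensor V s = LinearMap.lTensor V s ∘ₗ T) :
    ∃ B : V →ₗ[k] V, ∀ (v : V) (w : W), T (v ⊗ₜ w) = B v ⊗ₜ w := by
  classical
  rcases subsingleton_or_nontrivial W with hW | hW
  · exact ⟨0, fun v w => by rw [Subsingleton.elim w 0, TensorProduct.tmul_zero, map_zero, TensorProduct.tmul_zero]⟩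
  -- bases, a test vector `w₀ = c j₀` and the functional `λ₀ = c^*_{j₀}` with `λ₀ w₀ = 1`
  let b := Module.Basis.ofVectorSpace k V
  let c := Module.Basis.ofVectorSpace k W
  obtain ⟨j₀⟩ := c.index_nonempty
  set w₀ : W := c j₀ with hw₀
  set l₀ : Module.Dual k W := c.coord j₀ with hl₀
  have hl₀w₀ : l₀ w₀ = 1 := by
    rw [hl₀, hw₀, Module.Basis.coord_apply, Module.Basis.repr_self, Finsupp.single_eq_same]
  -- the candidate `B v := rid ((id ⊗ λ₀) (T (v ⊗ w₀)))`
  refine ⟨(TensorProduct.rid k V).toLinearMap ∘ₗ LinearMap.lTensor V l₀ ∘ₗ T ∘ₗ (TensorProduct.mk k V W).flip w₀,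
    fun v w => ?_⟩
  -- Schur on every slice: `sliceEnd T μ v = c(μ, v) • id`
  have hsc : ∀ μ : Module.Dual k V, ∃ a : k, sliceEnd T μ v = a • LinearMap.id :=
    fun μ => hS _ (sliceEnd_comm T hT μ v)
  -- compare coordinates in the tensor basis `b ⊗ c`
  apply (b.tensorProduct c).repr.injective
  ext ⟨i, j⟩
  obtain ⟨a, ha⟩ := hsc (b.coord i)
  have h1 : (b.tensorProduct c).repr (T (v ⊗ₜ[k] w)) (i, j) = a * c.repr w j := by
    rw [tensorProduct_repr_eq, ← sliceEnd_apply, ha, LinearMap.smul_apply, LinearMap.id_apply, map_smul,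
      Finsupp.smul_apply, smul_eq_mul]
  have h2 : b.repr (((TensorProduct.rid k V).toLinearMap ∘ₗ LinearMap.lTensor V l₀ ∘ₗ T ∘ₗ
      (TensorProduct.mk k V W).flip w₀) v) i = a := by
    rw [← Module.Basis.coord_apply, LinearMap.comp_apply, LinearMap.comp_apply, LinearMap.comp_apply,
      LinearMap.flip_apply, TensorProduct.mk_apply, LinearEquiv.coe_coe, dual_rid_lTensor_eq_dual_lid_rTensor,
      ← sliceEnd_apply, ha, LinearMap.smul_apply, LinearMap.id_apply, map_smul, smul_eq_mul, hl₀w₀, mul_one]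
  rw [h1, Module.Basis.tensorProduct_repr_tmul_apply, h2, smul_eq_mul, mul_comm]

/-- Operator form: `T = B ⊗ id`. [cite: MoeglinVignerasWaldspurger1987, Chap. 2 II.1 Rem. (6)] -/
theorem eq_rTensor_of_commute_lTensor {S : Set (W →ₗ[k] W)}
    (hS : ∀ f : W →ₗ[k] W, (∀ s ∈ S, f ∘ₗ s = s ∘ₗ f) → ∃ c : k, f = c • LinearMap.id)
    (T : V ⊗[k] W →ₗ[k] V ⊗[k] W) (hT : ∀ s ∈ S, T ∘ₗ LinearMap.lTensor V s = LinearMap.lTensor V s ∘ₗ T) :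
    ∃ B : V →ₗ[k] V, T = LinearMap.rTensor W B := by
  obtain ⟨B, hB⟩ := exists_tmul_eq_of_commute_lTensor hS T hT
  exact ⟨B, TensorProduct.ext' fun v w => by rw [hB, LinearMap.rTensor_tmul]⟩

/-- **`⊗ w₀`-cancellation over a field**: `v ⊗ w₀ = v' ⊗ w₀` with `w₀ ≠ 0` forces `v = v'` (so the `B` above is
unique when `W ≠ 0`). [folklore] -/
private theorem tmul_left_cancel_of_ne_zero_aux {w₀ : W} (hw₀ : w₀ ≠ 0) {v v' : V}
    (h : v ⊗ₜ[k] w₀ = v' ⊗ₜ[k] w₀) : v = v' := by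
  obtain ⟨l₀, hl₀⟩ : ∃ l₀ : Module.Dual k W, l₀ w₀ = 1 := Module.Projective.exists_dual_eq_one k hw₀
  have h1 := congrArg (fun z => TensorProduct.rid k V (LinearMap.lTensor V l₀ z)) h
  simp only [LinearMap.lTensor_tmul, TensorProduct.rid_tmul, hl₀, one_smul] at h1
  exact h1

/-- **Uniqueness of `B`**: if `T (v ⊗ w) = B v ⊗ w = B' v ⊗ w` for one `w ≠ 0` and all `v`, then `B = B'`.
[cite: MoeglinVignerasWaldspurger1987, Chap. 2 II.1 Rem. (6)] -/
theorem eq_of_tmul_eq_tmul {B B' : V →ₗ[k] V} {w₀ : W} (hw₀ : w₀ ≠ 0)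
    (h : ∀ v : V, B v ⊗ₜ[k] w₀ = B' v ⊗ₜ[k] w₀) : B = B' :=
  LinearMap.ext fun v => tmul_left_cancel_of_ne_zero_aux hw₀ (h v)

end Literature.LinearAlgebra
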